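import Literature.MathematicalPhysics.QuantumLattice.HeisenbergAFInfiniteVolumeThermalStates
import HarnessLib

/-!
# Translates of dKMS states are dKMS states; the Néel equilibrium states of the Heisenberg antiferromagnet
# break the translation symmetry of `ℤ^d`

Companion of `HeisenbergAFInfiniteVolumeThermalStates.lean` (dKMS = energy–entropy-balance states,
`InfVolState.IsDKMSState`) and `HeisenbergAFInfiniteVolumeGroundState.lean`.

* `InfVolState.IsDKMSState.shift` — for a translation-invariant finite-range interaction `Φ`, the translate
  `ω ∘ τ_v` of a dKMS state at `β` is a dKMS state at `β` (covariance of the generator,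
  `transportOp_shift_derivation`, Bratteli–Robinson II Thm. 6.2.4; the thermal twin of the tree's
  `InfVolState.IsGroundState.shift`).
* `XXZKT.heisenbergAF_dKMSState_translationSymmetryBreaking` — `d ≥ 3`, `S = n/2 ≥ ½`, `J > 0`, `β ≥ β₀`: the
  Néel dKMS state `ω` of `heisenbergAF_exists_dKMSState_neelOrder` is invariant under the EVEN translations but
  `ω ∘ τ_{e_i} ≠ ω` for every lattice direction `i`, and each `ω ∘ τ_{e_i}` is again a dKMS state: the unit
  translations are spontaneously broken in equilibrium at low temperature (Dyson–Lieb–Simon Néel order).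
* `XXZKT.heisenbergAF_groundState_translationSymmetryBreaking` — the same at `T = 0` for `d ≥ 2`, `(d, S) ≠ (2, ½)`
  (Kennedy–Lieb–Shastry / Koma–Tasaki ground-state Néel order), sharpening `heisenbergAF_not_hasUniqueGroundState`.

WHAT THIS IS NOT: no statement about KMS proper (dKMS ⟺ KMS, Bratteli–Robinson II Thm. 5.3.15, is cited, not
formalised); nothing about the Hubbard model.

## References
* [BratteliRobinsonII1997] O. Bratteli, D. W. Robinson, *OAQSM 2*, Thm. 6.2.4, §6.2.2, Thm. 5.3.15.
* [ArakiMoriya2003] H. Araki, H. Moriya, Rev. Math. Phys. 15 (2003) 93, Def. 6.3.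
* [DLS1978] F. J. Dyson, E. H. Lieb, B. Simon, J. Stat. Phys. **18** (1978) 335–383, Thm. 5.1.
* [KomaTasaki1993] T. Koma, H. Tasaki, CMP **158** (1993), §1 (1.8), Corollary 1.1.
* [Tasaki2020] H. Tasaki, *Physics and Mathematics of Quantum Many-Body Systems*, §4.4 (SSB, Néel order).
-/

noncomputable section

namespace Literature.MathematicalPhysics.QuantumLattice

open Matrix Finset _root_.Filter Literature.Probability.LatticeModels
  Literature.MathematicalPhysics.QuantumLattice.SpinOperators
open scoped _root_.Topology ComplexOrder

variable {d : ℕ}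

/-! ### Translates of dKMS states -/

namespace InfVolState

variable {q : ℕ}

/-- **Translates of dKMS states are dKMS states.**  For a translation-invariant interaction `Φ` (range parameter
`R`) and a dKMS state `ω` at `β`, the translated state `ω ∘ τ_v` is a dKMS state at `β`:
`(ω ∘ τ_v)(Ãᴴ δ_Λ A) = ω(τ_v(Ã)ᴴ δ_{Λ+v}(τ_v A))`, `(ω ∘ τ_v)(AᴴA) = ω(τ_v(A)ᴴ τ_v A)` by covariance of the
generator and of isotony (`transportOp_shift_derivation`), so the three clauses at `(Λ, A)` for `ω ∘ τ_v` are the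
clauses at `(Λ + v, τ_v A)` for `ω`. [cite: BratteliRobinsonII1997, Thm. 6.2.4 and §6.2.2] [cite: ArakiMoriya2003, Def 6.3] -/
theorem IsDKMSState.shift {ω : InfVolState d q} {Φ : LatticeInteraction d q} {R β : ℝ}
    (hω : ω.IsDKMSState Φ R β) (hΦ : Φ.IsTranslationInvariant) (v : Site d) :
    (ω.shift v).IsDKMSState Φ R β := by
  intro Λ A
  have hS : (thicken Λ R).map (Site.shift v).toEmbedding ⊆
      thicken (Λ.map (Site.shift v).toEmbedding) R := (thicken_map_shift Λ R v).ge
  have h := hω (Λ.map (Site.shift v).toEmbedding) (transportOp (finsetMapEquiv (Site.shift v).toEmbedding Λ) A)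
  simp only [InfVolState.shift_expect, transportOp_mul, transportOp_conjTranspose]
  rw [← ω.compatible hS, embedOp_mul, embedOp_conjTranspose, transportOp_shift_derivation hΦ R Λ v A hS,
    transportOp_shift_embedOp, embedOp_embedOp]
  exact h

end InfVolState

/-! ### Spontaneous breaking of the unit translations -/

namespace XXZKT

variable {n : ℕ} {J : ℝ}

/-- **TRANSLATION SYMMETRY BREAKING IN EQUILIBRIUM** (`d ≥ 3`, `S = n/2 ≥ ½`, `J > 0`): there is `β₀ > 0` such that
for every `β ≥ β₀` the Heisenberg antiferromagnet on `ℤ^d` has a dKMS state `ω` at `β`, invariant under the even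
translations, with `ω ∘ τ_{e_i} ≠ ω` for EVERY direction `i` — and each translate `ω ∘ τ_{e_i}` is itself a dKMS
state at `β`.  (`ω` = the Néel state of `heisenbergAF_exists_dKMSState_neelOrder`: its staggered magnetisation
`(-1)^x Re ω(Sˣ_x) ≥ √3σ > 0` has constant sign, which `τ_{e_i}` reverses.)
[cite: DLS1978, Thm. 5.1] [cite: KomaTasaki1993, §1 Corollary 1.1, (1.8)] [cite: Tasaki2020, §4.4]
[cite: BratteliRobinsonII1997, Thm. 6.2.4] -/
theorem heisenbergAF_dKMSState_translationSymmetryBreaking (hd : 3 ≤ d) (hn : 1 ≤ n) (hJ : 0 < J) :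
    ∃ β₀ : ℝ, 0 < β₀ ∧ ∀ β : ℝ, β₀ ≤ β → ∃ ω : InfVolState d (n + 1),
      ω.IsDKMSState (heisenbergLatticeInteraction d n J) 1 β ∧
      (∀ v : Site d, latticeStagger v = 1 → ω.shift v = ω) ∧
      ∀ i : Fin d, (ω.shift (unitVec i)).IsDKMSState (heisenbergLatticeInteraction d n J) 1 β ∧
        ω.shift (unitVec i) ≠ ω := by
  obtain ⟨β₀, hβ₀, H⟩ := heisenbergAF_exists_dKMSState_neelOrder hd hn hJ
  refine ⟨β₀, hβ₀, fun β hβ => ?_⟩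
  obtain ⟨σ, hσ, ω, hkms, -, hshift, -, hfloor⟩ := H β hβ
  refine ⟨ω, hkms, hshift, fun i => ⟨hkms.shift (isTranslationInvariant_heisenbergLatticeInteraction n J) _,
    fun heq => ?_⟩⟩
  have h1 := hfloor 0
  have h2 := hfloor ((0 : Site d) + unitVec i)
  rw [latticeStagger_add_unitVec, ← InfVolState.shift_expect_siteSpinAt ω (unitVec i) 0 0, heq, neg_mul] at h2
  have h3 : (0 : ℝ) < Real.sqrt 3 * σ := mul_pos (Real.sqrt_pos.2 (by norm_num)) hσ
  linarith

/-- **TRANSLATION SYMMETRY BREAKING IN THE GROUND STATE** (`d ≥ 2`, `S = n/2 ≥ ½`, `(d, S) ≠ (2, ½)`, `J > 0`): the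
Néel ground state `ω` of `heisenbergAF_exists_groundState_neelOrder` is invariant under the even translations, but
`ω ∘ τ_{e_i} ≠ ω` for every direction `i`, and each translate is again an infinite-volume ground state.
[cite: KomaTasaki1993, §1 Corollary 1.1, (1.8)] [cite: KennedyLiebShastryJSP1988, Theorem] [cite: Tasaki2020, §4.4]
[cite: BratteliRobinsonII1997, §6.2.7] -/
theorem heisenbergAF_groundState_translationSymmetryBreaking (hd : 2 ≤ d) (hn : 1 ≤ n) (hdn : ¬ (d = 2 ∧ n = 1))
    (hJ : 0 < J) :
    ∃ ω : InfVolState d (n + 1), ω ∈ groundStates (heisenbergLatticeInteraction d n J) 1 ∧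
      (∀ v : Site d, latticeStagger v = 1 → ω.shift v = ω) ∧
      ∀ i : Fin d, ω.shift (unitVec i) ∈ groundStates (heisenbergLatticeInteraction d n J) 1 ∧
        ω.shift (unitVec i) ≠ ω := by
  obtain ⟨σ, hσ, ω, hgs, hshift, -, hfloor⟩ := heisenbergAF_exists_groundState_neelOrder hd hn hdn hJ
  refine ⟨ω, hgs, hshift, fun i =>
    ⟨shift_mem_groundStates hgs (isTranslationInvariant_heisenbergLatticeInteraction n J) _, fun heq => ?_⟩⟩
  have h1 := hfloor 0
  have h2 := hfloor ((0 : Site d) + unitVec i)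
  rw [latticeStagger_add_unitVec, ← InfVolState.shift_expect_siteSpinAt ω (unitVec i) 0 0, heq, neg_mul] at h2
  have h3 : (0 : ℝ) < Real.sqrt 3 * σ := mul_pos (Real.sqrt_pos.2 (by norm_num)) hσ
  linarith

end XXZKT

end Literature.MathematicalPhysics.QuantumLattice

end
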